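import Summits.ValiantsHypothesis.ValiantsHypothesis.Theorems.GrenetZeonDualUnipotentThreeHalvesLongMassStrictUpperSubmodulePrice

/-!
# `GrenetZeon.DualUnipotentThreeHalves` (stmt-ValiantsHypothesis-24318), line `slow_core`, stub (c) `SlowCore.LongMassSlowLawInv`:
# TRIANGULAR CORNERS ARE EXPENSIVE — the two-sided price of `𝔫_b` transported to every placed copy `Ψ_σ(𝔫_s) ≤ M_b(ℂ)` (pluggable form)

✓ `…LongMassStrictUpperSubmodulePrice` prices the strictly upper triangular matrices `𝔫_s ≤ M_s(ℂ)` two-sidedly in the submodule currency of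
✓ p840930 `longMassSlowLawInv_iff_submodule` (`(P + n + 2s)² ≥ 2·n·s²` for every window pair; a window pair of cost `≤ n·k + (k+1)·C(⌈s/(k+1)⌉,2)`).
To make the LOWER bound usable on the species of the cell it must apply to a triangular CORNER of a bigger matrix space: for an injection
`σ : Fin s ↪ Fin b` let `Ψ_σ(𝔫_s) ≤ M_b(ℂ)` be the matrices supported on the positions `(σ a, σ c)`, `a < c` (any submodule `V'` with that membership
test).  Then:

* `sum_eq_sum_image_of_support`, `ext0_apply_image`, `ext0_pow_apply` — bookkeeping of the ZERO EXTENSION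
  `Ψ_σ M = of (i, j) ↦ Σ_{a,c} [σ a = i ∧ σ c = j]·M a c` (entries on the image, powers restrict: `((Ψ_σ L)^p)_{σ a, σ c} = (L^p)_{a c}`).
* ★★★ `two_mul_sq_le_of_window_corner` — every window pair `(W, k)` of `V' = Ψ_σ(𝔫_s)` (`s ≤ n`) has `(n·k + (dim V' − dim W) + n + 2s)² ≥ 2·n·s²`.

With ✓ `price_mono_submodule` (a window pair of `V ≥ V'` restricts to `V'` at no extra cost) and ✓ `price_conj_submodule`, EVERY nilpotent matrix space
containing a conjugate of a placed `𝔫_s` costs at least `√2·√n·s − n − 2s`: a by-name LOWER-BOUND ROW for the cell's species (`S₃(m) ⊇ 𝔫_{m−2}`-type bulks,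
`U^{hi}`, the all-`P` designs' Lagrangian Borel parts …), to be set against their certificates.

HONEST FRAMING.  Calibration instrument (`--supports stmt-ValiantsHypothesis-24318`); (c) `LongMassSlowLawInv` (∃ c) is RESEARCH — OPEN; closes no
stub; S3, 24318, 8062 (`stub_dualUnipotent`) and `VP ≠ VNP` are NOT proved.  Def-free, no named facts, no sorry.  [folklore]
-/

set_option linter.dupNamespace false
set_option autoImplicit false

noncomputable section

namespace Summit.ValiantsHypothesis.ValiantsHypothesis.Theorems.GrenetZeon.FreeTriangularPrice

open MvPolynomial Matrix
open scoped BigOperators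
open Summit.ValiantsHypothesis.ValiantsHypothesis.Cruxes.TwoDimCoefficients.DimTwoCases (AffMat IsAffine)
open Summit.ValiantsHypothesis.ValiantsHypothesis.Theorems.GrenetZeon.RadicalSplit (lineSubst)
open Summit.ValiantsHypothesis.ValiantsHypothesis.Theorems.GrenetZeon.SlowCore (linEntry Ledger RelCert)
open Summit.ValiantsHypothesis.ValiantsHypothesis.Theorems.GrenetZeon.ResolventFlag (pointMat linMat)
open Summit.ValiantsHypothesis.ValiantsHypothesis.Theorems.GrenetZeon.LongMassHomogenise (map_lineSubst_eq_add_smul codim_comap_eq)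

variable {n b s : ℕ}

/-! ## §1 Zero extension along an injection `σ : Fin s ↪ Fin b` -/

/-- A sum over `Fin b` of a function vanishing off the image of `σ` is the sum over `Fin s`. -/
theorem sum_eq_sum_image_of_support {R : Type*} [AddCommMonoid R] (σ : Fin s → Fin b) (hσ : Function.Injective σ)
    (f : Fin b → R) (hf : ∀ q, (∀ a, σ a ≠ q) → f q = 0) : ∑ q, f q = ∑ a, f (σ a) := by
  classical
  rw [← Finset.sum_image (f := f) (s := Finset.univ) (g := σ) (fun a _ c _ h => hσ h)]
  symm
  refine Finset.sum_subset (Finset.subset_univ _) fun q _ hq => hf q fun a ha => hq ?_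
  exact Finset.mem_image.mpr ⟨a, Finset.mem_univ _, ha⟩

/-- Entries of the zero extension on the image of `σ`. -/
theorem ext0_apply_image {R : Type*} [AddCommMonoid R] (σ : Fin s → Fin b) (hσ : Function.Injective σ)
    (M : Matrix (Fin s) (Fin s) R) (a c : Fin s) :
    (∑ a', ∑ c', if σ a' = σ a ∧ σ c' = σ c then M a' c' else 0) = M a c := by
  classical
  rw [Finset.sum_eq_single a, Finset.sum_eq_single c]
  · rw [if_pos ⟨rfl, rfl⟩]
  · intro c' _ hc'; rw [if_neg]; rintro ⟨-, h⟩; exact hc' (hσ h)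
  · intro h; exact absurd (Finset.mem_univ _) h
  · intro a' _ ha'
    refine Finset.sum_eq_zero fun c' _ => ?_
    rw [if_neg]; rintro ⟨h, -⟩; exact ha' (hσ h)
  · intro h; exact absurd (Finset.mem_univ _) h

/-- Entries of the zero extension off the image of `σ` (in the column) vanish. -/
theorem ext0_apply_off_col {R : Type*} [AddCommMonoid R] (σ : Fin s → Fin b) (M : Matrix (Fin s) (Fin s) R) (i j : Fin b)
    (hj : ∀ c, σ c ≠ j) : (∑ a', ∑ c', if σ a' = i ∧ σ c' = j then M a' c' else 0) = 0 :=
  Finset.sum_eq_zero fun a' _ => Finset.sum_eq_zero fun c' _ => by rw [if_neg]; rintro ⟨-, h⟩; exact hj c' h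

/-- Entries of the zero extension off the image of `σ` (in the row) vanish. -/
theorem ext0_apply_off_row {R : Type*} [AddCommMonoid R] (σ : Fin s → Fin b) (M : Matrix (Fin s) (Fin s) R) (i j : Fin b)
    (hi : ∀ a, σ a ≠ i) : (∑ a', ∑ c', if σ a' = i ∧ σ c' = j then M a' c' else 0) = 0 :=
  Finset.sum_eq_zero fun a' _ => Finset.sum_eq_zero fun c' _ => by rw [if_neg]; rintro ⟨h, -⟩; exact hi a' h

/-- ★ Powers restrict to the corner: `((Ψ_σ L)^p)_{σ a, σ c} = (L^p)_{a c}`. -/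
theorem ext0_pow_apply {R : Type*} [CommSemiring R] (σ : Fin s → Fin b) (hσ : Function.Injective σ) (L : Matrix (Fin s) (Fin s) R) :
    ∀ (p : ℕ) (a c : Fin s),
      ((Matrix.of fun i j => ∑ a', ∑ c', if σ a' = i ∧ σ c' = j then L a' c' else 0) ^ p) (σ a) (σ c) = (L ^ p) a c := by
  classical
  intro p
  induction p with
  | zero =>
    intro a c
    simp only [pow_zero, Matrix.one_apply, hσ.eq_iff]
  | succ p ih =>
    intro a c
    rw [pow_succ, pow_succ, Matrix.mul_apply, Matrix.mul_apply]
    rw [sum_eq_sum_image_of_support σ hσ _ (fun q hq => by rw [Matrix.of_apply, ext0_apply_off_row σ L q (σ c) hq, mul_zero])]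
    refine Finset.sum_congr rfl fun a' _ => ?_
    rw [ih a a', Matrix.of_apply, ext0_apply_image σ hσ L a' c]

/-! ## §2 The corner price -/

/-- ★★★ **TRIANGULAR CORNERS ARE EXPENSIVE.**  Let `σ : Fin s → Fin b` be injective (`s ≤ n`) and `V' ≤ M_b(ℂ)` the matrices supported on
`{(σ a, σ c) : a < c}`.  Every window pair `(W, k)` of `V'` has cost `P = n·k + (dim V' − dim W)` with `(P + n + 2s)² ≥ 2·n·s²`. -/
theorem two_mul_sq_le_of_window_corner (hsn : s ≤ n) (σ : Fin s → Fin b) (hσ : Function.Injective σ)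
    (V' : Submodule ℂ (Matrix (Fin b) (Fin b) ℂ))
    (hV' : ∀ A : Matrix (Fin b) (Fin b) ℂ, A ∈ V' ↔ ∀ i j, A i j ≠ 0 → ∃ a c : Fin s, a < c ∧ σ a = i ∧ σ c = j)
    (W : Submodule ℂ (Matrix (Fin b) (Fin b) ℂ)) (k : ℕ) (hWV : W ≤ V')
    (hwin : ∀ A ∈ V', ∀ w ∈ W, ∀ p : ℕ, p ≤ n - 1 → ∀ i j : Fin b,
      (((A.map (C : ℂ → MvPolynomial (Fin 1) ℂ) + (X 0 : MvPolynomial (Fin 1) ℂ) • w.map C) ^ p :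
        Matrix (Fin b) (Fin b) (MvPolynomial (Fin 1) ℂ)) i j).totalDegree ≤ k) :
    2 * n * (s * s) ≤ (n * k + (Module.finrank ℂ V' - Module.finrank ℂ W) + n + 2 * s) ^ 2 := by
  classical
  -- the free `s × s` pencil and the zero-extended linear-part map `T v = Ψ_σ (lin v)`
  set ι : Fin s → Fin n := Fin.castLE hsn with hι
  have hιinj : Function.Injective ι := Fin.castLE_injective hsn
  set N : AffMat n s := Matrix.of fun i j => if i < j then X (ι i, ι j) else 0 with hNdef
  have hN : ∀ i j, N i j = if i < j then X (ι i, ι j) else 0 := fun i j => rfl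
  obtain ⟨h0, hsurj⟩ := free_std_spec hsn N hN
  have haff := isAffine_free ι N hN
  obtain ⟨Ψ, hΨapp⟩ : ∃ Ψ : Matrix (Fin s) (Fin s) ℂ →ₗ[ℂ] Matrix (Fin b) (Fin b) ℂ,
      ∀ M i j, Ψ M i j = ∑ a', ∑ c', if σ a' = i ∧ σ c' = j then M a' c' else 0 := by
    refine ⟨{ toFun := fun M => Matrix.of fun i j => ∑ a', ∑ c', if σ a' = i ∧ σ c' = j then M a' c' else 0
              map_add' := fun M M' => ?_
              map_smul' := fun t M => ?_ }, fun M i j => rfl⟩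
    · ext i j
      simp only [Matrix.of_apply, Matrix.add_apply, ← Finset.sum_add_distrib]
      refine Finset.sum_congr rfl fun a' _ => Finset.sum_congr rfl fun c' _ => ?_
      split_ifs <;> simp
    · ext i j
      simp only [Matrix.of_apply, Matrix.smul_apply, smul_eq_mul, Finset.mul_sum, RingHom.id_apply]
      refine Finset.sum_congr rfl fun a' _ => Finset.sum_congr rfl fun c' _ => ?_
      split_ifs <;> simp
  obtain ⟨T₀, hT₀⟩ := Summit.ValiantsHypothesis.ValiantsHypothesis.Theorems.GrenetZeon.LedgerIndex.exists_linearMap_linMat N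
  set T : (Fin n × Fin n → ℂ) →ₗ[ℂ] Matrix (Fin b) (Fin b) ℂ := Ψ ∘ₗ T₀ with hTdef
  have hT : ∀ v, T v = Ψ (linMat N v) := fun v => by rw [hTdef, LinearMap.comp_apply, hT₀]
  -- `Ψ` of a strictly upper matrix lies in `V'`; every element of `V'` is such a `Ψ`
  have hΨmem : ∀ M : Matrix (Fin s) (Fin s) ℂ, (∀ a c, ¬ a < c → M a c = 0) → Ψ M ∈ V' := by
    intro M hM
    rw [hV']
    intro i j hij
    by_cases hi : ∃ a, σ a = i
    · obtain ⟨a, rfl⟩ := hi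
      by_cases hj : ∃ c, σ c = j
      · obtain ⟨c, rfl⟩ := hj
        rw [hΨapp, ext0_apply_image σ hσ] at hij
        exact ⟨a, c, by by_contra h; exact hij (hM a c h), rfl, rfl⟩
      · push Not at hj
        exact absurd (ext0_apply_off_col σ M _ _ hj) (by rw [hΨapp] at hij; exact hij)
    · push Not at hi
      exact absurd (ext0_apply_off_row σ M _ _ hi) (by rw [hΨapp] at hij; exact hij)
  have hrange : LinearMap.range T = V' := by
    apply le_antisymm
    · rintro _ ⟨y, rfl⟩
      rw [hT]
      exact hΨmem _ fun a c hac => by rw [linMat_free ι N hN, if_neg hac]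
    · intro A hA
      have hsupp := (hV' A).mp hA
      -- `A = Ψ (A.submatrix σ σ)` and the corner is strictly upper
      have hup : ∀ a c, ¬ a < c → A.submatrix σ σ a c = 0 := by
        intro a c hac
        by_contra h
        obtain ⟨a', c', hlt, ha, hc⟩ := hsupp _ _ h
        rw [hσ ha, hσ hc] at hlt
        exact hac hlt
      obtain ⟨y, hy⟩ := hsurj _ hup
      refine ⟨y, ?_⟩
      rw [hT, hy]
      ext i j
      rw [hΨapp]
      by_cases hi : ∃ a, σ a = i
      · obtain ⟨a, rfl⟩ := hi
        by_cases hj : ∃ c, σ c = j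
        · obtain ⟨c, rfl⟩ := hj
          rw [ext0_apply_image σ hσ]; rfl
        · push Not at hj
          rw [ext0_apply_off_col σ _ _ _ hj]
          by_contra h
          obtain ⟨a', c', -, -, hc⟩ := hsupp _ _ (Ne.symm h)
          exact hj c' hc
      · push Not at hi
        rw [ext0_apply_off_row σ _ _ _ hi]
        by_contra h
        obtain ⟨a', c', -, ha, -⟩ := hsupp _ _ (Ne.symm h)
        exact hi a' ha
  -- the pencil certificate `(W.comap T, k)`
  have hcert : RelCert n s N (n * k + (Module.finrank ℂ V' - Module.finrank ℂ W)) := by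
    refine ⟨W.comap T, k, ?_, ?_⟩
    · intro x v hv p hp a c _ _
      rw [map_lineSubst_eq_add_smul N haff h0]
      have hvW : Ψ (linMat N v) ∈ W := by rw [← hT]; exact Submodule.mem_comap.mp hv
      have hxV : Ψ (linMat N x) ∈ V' := by rw [← hrange, ← hT]; exact LinearMap.mem_range_self T x
      have hdeg := hwin _ hxV _ hvW p hp (σ a) (σ c)
      -- the line matrix of the extensions is the extension of the line matrix
      have hline : (Ψ (linMat N x)).map (C : ℂ → MvPolynomial (Fin 1) ℂ) + (X 0 : MvPolynomial (Fin 1) ℂ) • (Ψ (linMat N v)).map C =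
          Matrix.of fun i j => ∑ a', ∑ c', if σ a' = i ∧ σ c' = j then
            (((linMat N x).map (C : ℂ → MvPolynomial (Fin 1) ℂ) + (X 0 : MvPolynomial (Fin 1) ℂ) • (linMat N v).map C :
              Matrix (Fin s) (Fin s) (MvPolynomial (Fin 1) ℂ)) a' c') else 0 := by
        refine Matrix.ext fun i j => ?_
        simp only [hΨapp, Matrix.add_apply, Matrix.smul_apply, Matrix.map_apply, Matrix.of_apply, smul_eq_mul, map_sum, Finset.mul_sum,
          ← Finset.sum_add_distrib]
        refine Finset.sum_congr rfl fun a' _ => Finset.sum_congr rfl fun c' _ => ?_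
        split_ifs <;> simp
      rw [hline, ext0_pow_apply σ hσ _ p a c] at hdeg
      exact hdeg
    · rw [codim_comap_eq T W (by rw [hrange]; exact hWV), hrange]
  exact two_mul_sq_le_of_relCert ι hιinj N hN hcert

end Summit.ValiantsHypothesis.ValiantsHypothesis.Theorems.GrenetZeon.FreeTriangularPrice

end
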